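import Summits.BirchSwinnertonDyer.Rank1Residual.X11b.LocalTorsionMultiplicative
import Literature.NumberTheory.EllipticCurves.TateParameterPrimeTorsion
import Literature.NumberTheory.EllipticCurves.TateCurve.UniformizationPoints
import Literature.NumberTheory.EllipticCurves.PAdicHeightsProofs
import Literature.NumberTheory.EllipticCurves.PAdicHeightsTateValuationProofs
import HarnessLib

/-!
# Route `UniversalToricDescent`, cruxes `TwinSplitIMCAtThreeMult` (stmt-BirchSwinnertonDyer-20694, bucket B) and ♭B
# `TwinWanFrameAtThreeMult` (stmt-BirchSwinnertonDyer-26062), lines `threeframes` v5 / `membertower` v2, stub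
# `stub_wanFrameMultNoDec`: the local binder (dec) `E(ℚ_p)[p] = 0` at a multiplicative `p ≥ 3` DECIDED EXACTLY and
# UNCONDITIONALLY — it fails iff `p` is split with Tate parameter a `p`-th power in `ℚ_p` — so the residual locus of the
# member-tower line shrinks from «split ∧ 3 ∣ v₃(Δ_min)» to «split ∧ q_{W′} ∈ (ℚ₃ˣ)³», and is TIGHT there

Cell `bsd-wall` (run/shared/lean/pub/bsd-wall/), width seat `bsd-wall-utd-p2-w2` (prover g2, 2026-08-28);
`--supports stmt-BirchSwinnertonDyer-20694 --as helper`; Theses-free.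

## Context (numbers, not adjectives)

The LEAD's descent kernel for the rational Wan frame of the 3-multiplicative twin `W′`
(`twin_exists_wanFrame_of_sigmaData_of_memberTower`, p609906) carries ONE local binder, (dec)
`hiv : ∀ Q : W′(ℚ₃), 3 • Q = 0 → Q = 0`, fed to the member congruence `e_m` (p609362). Skeleton v5 of line
`threeframes` (and v2 of `membertower`) discharges (dec) by the tree theorem
`X11b.LocalTorsion.localTorsion_eq_zero_of_mult` on «non-split ∨ 3 ∤ v₃(Δ_min(W′))» [Silverman AEC VII.6.1 / Ex. 3.5]
and keeps the complement «split ∧ 3 ∣ v₃(Δ_min)» as the research stub `stub_wanFrameMultNoDec`. But the tree ALSO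
holds, all PROVED: Tate's uniformisation `E(ℚ_p) ≅ ℚ_pˣ/q^ℤ` (`TateCurve.tateUniformization_points_holds`, Silverman
ATAEC V.3.1/V.5.3), the existence of a Tate parameter datum at a split multiplicative prime
(`nonempty_tateParameterData_iff_holds`), its uniqueness (`TateParameterData.q_unique_holds`), `ord_p q = ord_p Δ_min`
(`valuation_q_eq_padicValInt_holds`) and the Tate test `E(ℚ_p)[p] = 0 ⟺ q ∉ (ℚ_p)^p`
(`forall_prime_smul_eq_zero_iff_not_exists_pow_eq_tateParameter`, stated below the named fact
`tateUniformization_points`). Composing them: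

* §1 `localTorsion_eq_zero_iff_not_exists_pow_eq_tateParameter` — **(dec) ⟺ `q ∉ (ℚ_p)^p`, UNCONDITIONAL** (any
  `E/ℚ`, odd `p`, any Tate datum `D`); `exists_ne_zero_prime_smul_eq_zero_of_exists_pow_eq_tateParameter` — the
  converse direction spelled out: **`q ∈ (ℚ_p)^p` ⟹ a NON-ZERO `P ∈ E(ℚ_p)` with `pP = O`** (tightness);
  `not_exists_pow_eq_tateParameter_of_not_dvd` — `p ∤ v_p(Δ_min)` ⟹ `q ∉ (ℚ_p)^p` (the old locus contains the new).
* §2 `localTorsion_eq_zero_of_mult_of_forall_not_exists_pow` — **at a multiplicative `p ≥ 3`: (dec) holds as soon as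
  no Tate datum has `q ∈ (ℚ_p)^p`** (non-split: `localTorsion_eq_zero_of_nonsplit`; split: §1 at the datum that
  exists); `localTorsion_eq_zero_of_mult_iff` — **(dec) ⟺ `∀ D : TateParameterData W p, q_D ∉ (ℚ_p)^p`**, the exact,
  census-decidable (dec)-locus; `exists_tateParameterData_pow_of_not_localTorsion` — its contrapositive reading.
* §3 (`p = 3`, the twin binders of `stub_wanFrameMultNoDec`) `twin_dec_of_forall_not_cube`,
  `twin_not_dec_of_cube`, `twin_dec_or_cube` — the by_cases split the LEAD's `wanFrameMult_of_stubs` can run on: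
  EITHER (dec) holds (member-tower branch, k = 0) OR `W′` is split multiplicative at 3 with `q_{W′} = u³`, `u ∈ ℚ₃`
  — and on the latter (dec) is FALSE (`twin_not_dec_of_cube`), so no reshaping of the (dec)-based member congruence
  reaches it: the residual stub may be RE-TYPED with the extra binders
  `(D : TateParameterData W' 3) (u : ℚ_[3]) (hu : u ^ 3 = D.q)` in place of
  `W'.HasSplitMultiplicativeReductionAtPrime 3 → 3 ∣ v₃(Δ_min(W′))` (strictly fewer twins: `3 ∣ v₃(q)` AND the unit
  part of `q` a cube, i.e. `≡ ±1 (mod 9)`).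

HONEST FRAMING: theorems only (no definition, no named fact, no instance, no `sorry`); every input is a PROVED tree
theorem — nothing here is conditional; nothing is booked; the residual stub is not proved (it is research: on the cube
locus the strict condition induced on `W′[3^m]` at `𝔭′` is `W′(K_{𝔭′})[3^∞]/3^m ≠ 0`); BSD is proved for no curve;
no census number moves (census ask D7′ can now count «split ∧ q cube» instead of «split ∧ 3 ∣ v₃(Δ_min)»).

References: [SilvermanATAEC1994] Thm. V.3.1 (c)(d), Lemma V.5.1, Thm. V.5.3; [SilvermanAEC2009] VII.3.1, VII.6.1, Ex. 3.5;
[Serre1973] Ch. II §3.2 Thm. 2 (`μ_p(ℚ_p) = 1`, `p` odd); [SkinnerZhang2014] Thm. 1.1 (b); [Castella2018Erratum]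
Thm. A′ (2) and Remark (p. 2) («condition (b) of [SZ14]»).
-/

noncomputable section

open scoped Classical

set_option linter.dupNamespace false
set_option autoImplicit false

namespace Summit.BirchSwinnertonDyer.BirchSwinnertonDyer.Theorems.UniversalToricDescentTwinDecLocus

open WeierstrassCurve Literature.NumberTheory.EllipticCurves Literature.NumberTheory.EllipticCurves.Rank1Residual
  Summit.BirchSwinnertonDyer.Rank1Residual.X11b

/-! ### §1 The Tate test, unconditional -/

section TateTest

variable {p : ℕ} [hp : Fact p.Prime] (W : WeierstrassCurve ℚ) [W.IsElliptic]

/-- **(dec) ⟺ `q ∉ (ℚ_p)^p`, UNCONDITIONALLY**: for `E/ℚ`, an odd prime `p` and a Tate parameter datum `D` at `p`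
(so `p` is split multiplicative, `q_E = D.q`), `E(ℚ_p)[p] = 0` iff `q_E` is not a `p`-th power in `ℚ_p` — the tree's
`forall_prime_smul_eq_zero_iff_not_exists_pow_eq_tateParameter` with its only named-fact binder
`tateUniformization_points` DISCHARGED by `TateCurve.tateUniformization_points_holds`.
[cite: SilvermanATAEC1994, Thm. V.3.1 (d) and Thm. V.5.3] [cite: Serre1973, Ch. II §3.2 Thm. 2] -/
theorem localTorsion_eq_zero_iff_not_exists_pow_eq_tateParameter (hp2 : p ≠ 2) (D : TateParameterData W p) :
    (∀ P : (W.baseChange ℚ_[p]).toAffine.Point, p • P = 0 → P = 0) ↔ ¬ ∃ u : ℚ_[p], u ^ p = D.q :=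
  forall_prime_smul_eq_zero_iff_not_exists_pow_eq_tateParameter W TateCurve.tateUniformization_points_holds hp2 D

/-- **Tightness: `q ∈ (ℚ_p)^p` ⟹ `E(ℚ_p)[p] ≠ 0`** — a NON-ZERO `ℚ_p`-point killed by `p` exists (the class of a
`p`-th root `u` of `q` in `ℚ_pˣ/q^ℤ`), unconditionally. [cite: SilvermanATAEC1994, Thm. V.3.1 (d) and Thm. V.5.3] -/
theorem exists_ne_zero_prime_smul_eq_zero_of_exists_pow_eq_tateParameter (hp2 : p ≠ 2)
    (D : TateParameterData W p) (hq : ∃ u : ℚ_[p], u ^ p = D.q) :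
    ∃ P : (W.baseChange ℚ_[p]).toAffine.Point, P ≠ 0 ∧ p • P = 0 :=
  (prime_torsion_ne_zero_iff_exists_pow_eq_tateParameter W TateCurve.tateUniformization_points_holds hp2 D).2 hq

/-- **A `p`-th power has valuation divisible by `p`**: if `u ^ p = q` in `ℚ_p` then `(p : ℤ) ∣ v_p(q)`
(`v_p(u^p) = p·v_p(u)`). [folklore] -/
theorem dvd_valuation_of_pow_eq {u q : ℚ_[p]} (hu : u ^ p = q) : (p : ℤ) ∣ q.valuation :=
  ⟨u.valuation, by rw [← hu, Padic.valuation_pow]⟩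

/-- **The old locus contains the new one**: at a globally minimal `E/ℚ` with a Tate datum at `p`, `p ∤ v_p(Δ_min)`
forces `q ∉ (ℚ_p)^p` (`v_p(q) = v_p(Δ_min)`, `valuation_q_eq_padicValInt_holds`). [cite: MazurTateTeitelbaum1986Invent, §II.1] -/
theorem not_exists_pow_eq_tateParameter_of_not_dvd [W.IsGloballyMinimal] (D : TateParameterData W p)
    (hv : ¬ p ∣ padicValInt p W.minimalDiscriminantInt) : ¬ ∃ u : ℚ_[p], u ^ p = D.q := by
  rintro ⟨u, hu⟩
  have hdvd : (p : ℤ) ∣ D.q.valuation := dvd_valuation_of_pow_eq hu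
  rw [TateParameterData.valuation_q_eq_padicValInt_holds D] at hdvd
  exact hv (by exact_mod_cast hdvd)

end TateTest

/-! ### §2 (dec) at a multiplicative `p ≥ 3`, decided exactly -/

section Mult

variable {p : ℕ} [hp : Fact p.Prime] (W : WeierstrassCurve ℚ) [W.IsElliptic] [W.IsGloballyMinimal]

/-- **(dec) from «no Tate datum with `q ∈ (ℚ_p)^p`»** at a multiplicative prime `p ≥ 3`: if `p` is non-split this is
the tree's `localTorsion_eq_zero_of_nonsplit` [Silverman AEC VII.6.1 / Ex. 3.5]; if split, a Tate datum exists
(`nonempty_tateParameterData_iff_holds`) and §1 applies to it. Unconditional.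
[cite: SilvermanATAEC1994, Thm. V.5.3] [cite: SilvermanAEC2009, Thm VII.6.1 and Exercise 3.5] -/
theorem localTorsion_eq_zero_of_mult_of_forall_not_exists_pow (hp3 : 3 ≤ p) (hmult : Mult W p)
    (h : ∀ D : TateParameterData W p, ¬ ∃ u : ℚ_[p], u ^ p = D.q) :
    ∀ P : (W.baseChange ℚ_[p]).toAffine.Point, p • P = 0 → P = 0 := by
  have hp2 : p ≠ 2 := by omega
  by_cases hsplit : W.HasSplitMultiplicativeReductionAtPrime p
  · obtain ⟨D⟩ := (nonempty_tateParameterData_iff_holds W p).2 hsplit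
    exact (localTorsion_eq_zero_iff_not_exists_pow_eq_tateParameter W hp2 D).2 (h D)
  · exact LocalTorsion.localTorsion_eq_zero_of_nonsplit W p hp3 hmult hsplit

/-- **THE EXACT (dec)-LOCUS at a multiplicative `p ≥ 3`**: `E(ℚ_p)[p] = 0` iff no Tate parameter datum of `E` at `p`
has `q ∈ (ℚ_p)^p` (vacuous at non-split `p`, where no datum exists; at split `p` the datum is unique). Unconditional.
[cite: SilvermanATAEC1994, Thm. V.3.1 (d), Lemma V.5.1 and Thm. V.5.3] [cite: SilvermanAEC2009, Thm VII.6.1 and Exercise 3.5] -/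
theorem localTorsion_eq_zero_of_mult_iff (hp3 : 3 ≤ p) (hmult : Mult W p) :
    (∀ P : (W.baseChange ℚ_[p]).toAffine.Point, p • P = 0 → P = 0) ↔
      ∀ D : TateParameterData W p, ¬ ∃ u : ℚ_[p], u ^ p = D.q := by
  refine ⟨fun h D => ?_, localTorsion_eq_zero_of_mult_of_forall_not_exists_pow W hp3 hmult⟩
  exact (localTorsion_eq_zero_iff_not_exists_pow_eq_tateParameter W (by omega) D).1 h

/-- **Contrapositive reading**: at a multiplicative `p ≥ 3`, a non-zero `P ∈ E(ℚ_p)` with `pP = O` forces `p` SPLIT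
with `q_E` a `p`-th power — a Tate datum `D` and `u ∈ ℚ_p` with `u^p = D.q` exist. Unconditional.
[cite: SilvermanATAEC1994, Thm. V.3.1 (d) and Thm. V.5.3] [cite: SilvermanAEC2009, Thm VII.6.1 and Exercise 3.5] -/
theorem exists_tateParameterData_pow_of_not_localTorsion (hp3 : 3 ≤ p) (hmult : Mult W p)
    (h : ∃ P : (W.baseChange ℚ_[p]).toAffine.Point, P ≠ 0 ∧ p • P = 0) :
    ∃ (D : TateParameterData W p) (u : ℚ_[p]), u ^ p = D.q := by
  by_contra hne
  push Not at hne
  obtain ⟨P, hP0, hPp⟩ := h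
  exact hP0 (localTorsion_eq_zero_of_mult_of_forall_not_exists_pow W hp3 hmult
    (fun D ⟨u, hu⟩ => hne D u hu) P hPp)

/-- The old sufficient condition through the new one: «non-split ∨ `p ∤ v_p(Δ_min)`» ⟹ no Tate datum with
`q ∈ (ℚ_p)^p` (non-split: no datum at all, `D.split`; else `not_exists_pow_eq_tateParameter_of_not_dvd`).
[cite: SilvermanATAEC1994, Thm. V.5.3] [cite: MazurTateTeitelbaum1986Invent, §II.1] -/
theorem forall_not_exists_pow_of_nonsplit_or_not_dvd
    (h : ¬ W.HasSplitMultiplicativeReductionAtPrime p ∨ ¬ p ∣ padicValInt p W.minimalDiscriminantInt) :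
    ∀ D : TateParameterData W p, ¬ ∃ u : ℚ_[p], u ^ p = D.q := fun D =>
  h.elim (fun hns => absurd D.split hns) (fun hv => not_exists_pow_eq_tateParameter_of_not_dvd W D hv)

end Mult

/-! ### §3 `p = 3`: the twin binders of `stub_wanFrameMultNoDec` -/

section Twin

variable (W' : WeierstrassCurve ℚ) [W'.IsElliptic] [W'.IsGloballyMinimal]

/-- **(dec) for the 3-multiplicative twin OFF the cube locus**: `Mult W′ 3` and «no Tate datum of `W′` at 3 with
`q = u³`, `u ∈ ℚ₃`» ⟹ `W′(ℚ₃)[3] = 0` — the binder `hiv` of `twin_exists_wanFrame_of_sigmaData_of_memberTower`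
(p609906) and of `twin_fittingCongruenceFrameTwoSlotAt_of_memberTower`. Unconditional.
[cite: SilvermanATAEC1994, Thm. V.3.1 (d) and Thm. V.5.3] [cite: SilvermanAEC2009, Thm VII.6.1 and Exercise 3.5] -/
theorem twin_dec_of_forall_not_cube (hmult : Mult W' 3)
    (h : ∀ D : TateParameterData W' 3, ¬ ∃ u : ℚ_[3], u ^ 3 = D.q) :
    ∀ Q : (W'.baseChange ℚ_[3]).toAffine.Point, 3 • Q = 0 → Q = 0 :=
  localTorsion_eq_zero_of_mult_of_forall_not_exists_pow W' le_rfl hmult h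

omit [W'.IsGloballyMinimal] in
/-- **ON the cube locus (dec) is FALSE**: a Tate datum `D` of `W′` at 3 with `q = u³` gives a non-zero `Q ∈ W′(ℚ₃)`
with `3Q = O`; so the member congruence `e_m` of p609362 (which consumes (dec)) is unavailable there as typed — the
residual stub is genuine on exactly this locus. Unconditional. [cite: SilvermanATAEC1994, Thm. V.3.1 (d) and Thm. V.5.3] -/
theorem twin_not_dec_of_cube (D : TateParameterData W' 3) (hq : ∃ u : ℚ_[3], u ^ 3 = D.q) :
    ¬ ∀ Q : (W'.baseChange ℚ_[3]).toAffine.Point, 3 • Q = 0 → Q = 0 := by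
  obtain ⟨P, hP0, hP3⟩ :=
    exists_ne_zero_prime_smul_eq_zero_of_exists_pow_eq_tateParameter W' (by norm_num) D hq
  exact fun h => hP0 (h P hP3)

/-- **The by_cases split for `wanFrameMult_of_stubs`** (skeleton v5 of `threeframes` / v2 of `membertower`): at a
3-multiplicative twin EITHER (dec) holds — run the member tower through the descent kernel, `k = 0` — OR there is a
Tate datum `D` at 3 (so `W′` is SPLIT multiplicative at 3, `D.split`) and `u ∈ ℚ₃` with `u³ = D.q` — the residual
locus, on which the stub may be re-typed with the binders `(D : TateParameterData W' 3) (u : ℚ_[3]) (hu : u ^ 3 = D.q)`.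
Unconditional. [cite: SilvermanATAEC1994, Thm. V.3.1 (d) and Thm. V.5.3] [cite: SilvermanAEC2009, Thm VII.6.1 and Exercise 3.5] -/
theorem twin_dec_or_cube (hmult : Mult W' 3) :
    (∀ Q : (W'.baseChange ℚ_[3]).toAffine.Point, 3 • Q = 0 → Q = 0) ∨
      ∃ (D : TateParameterData W' 3) (u : ℚ_[3]), u ^ 3 = D.q := by
  by_cases h : ∃ (D : TateParameterData W' 3) (u : ℚ_[3]), u ^ 3 = D.q
  · exact Or.inr h
  · push Not at h
    exact Or.inl (twin_dec_of_forall_not_cube W' hmult fun D ⟨u, hu⟩ => h D u hu)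

/-- **The cube locus lies inside the LEAD's residual locus** «split ∧ `3 ∣ v₃(Δ_min(W′))`»: a Tate datum with
`q = u³` gives `D.split` and `3 ∣ v₃(q) = v₃(Δ_min)`. (The inclusion is strict in general: `3 ∣ v₃(q)` with unit
part `≢ ±1 (mod 9)` is in the old locus but not in the new.) [cite: MazurTateTeitelbaum1986Invent, §II.1] -/
theorem split_and_dvd_of_cube (D : TateParameterData W' 3) (hq : ∃ u : ℚ_[3], u ^ 3 = D.q) :
    W'.HasSplitMultiplicativeReductionAtPrime 3 ∧ 3 ∣ padicValInt 3 W'.minimalDiscriminantInt := by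
  refine ⟨D.split, ?_⟩
  by_contra hv
  exact not_exists_pow_eq_tateParameter_of_not_dvd W' D hv hq

end Twin

end Summit.BirchSwinnertonDyer.BirchSwinnertonDyer.Theorems.UniversalToricDescentTwinDecLocus

end
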